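import Summits.CriticalPhenomena.SAWScalingLimit.Theorems.SAWTotalPositivityBoundaryTP2Defs
import Summits.CriticalPhenomena.SAWScalingLimit.Theorems.SAWTotalPositivityBoundaryTP2Kernel
import Summits.CriticalPhenomena.SAWScalingLimit.Theorems.SAWTotalPositivityBoundaryTP2Symmetry
import Summits.CriticalPhenomena.SAWScalingLimit.Theorems.SAWTotalPositivityBoundaryTP2FirstStep
import Summits.CriticalPhenomena.SAWScalingLimit.Theorems.SAWTotalPositivityBoundaryTP2Avoid
import Summits.CriticalPhenomena.SAWScalingLimit.Theorems.SAWTotalPositivityBoundaryTP2SquareGadget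
import Summits.CriticalPhenomena.SAWScalingLimit.Theorems.SAWTotalPositivityBoundaryTP2Strip3RecCornerAux
import Summits.CriticalPhenomena.SAWScalingLimit.Theorems.EdgeOfPositivity.Negative.EdgeOfPositivityRectDomain
import HarnessLib

/-!
# Crux `BoundaryTP2` (stmt-CriticalPhenomena-7115), line `Sketch`: last-column recursion of the
3-row strip into a corner

Tool stub `stub_strip3_recCorner` of the line's skeleton (the 3-row strip programme). On the
strips `S_L = discreteDomainGraph (rectDomain L 2) 1` (sites `{0..L} × {0,1,2}`, lattice
adjacency), for the fugacity-`x` self-avoiding path kernel `Z` from `a = (0,r)` into the corner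
`t = (L+1,s)` of `S_{L+1}` (`s ∈ {0,2}`, `s̄ = 2-s`):

  `Z_{S_{L+1}}(a,t) = x Z_{S_L}(a,(L,s)) + x² Z_{S_L}(a,(L,1)) + x³ Z_{S_L}(a,(L,s̄)) + x⁴ PP`,
  `PP = Σ_{γ : a → (L,s̄), γ' : (L,1) → (L,s), γ ∩ γ' = ∅} x^{|γ| + |γ'|}`   (paths of `S_L`),

given that every `S_L`-path `a → (L,1)` meets every `S_L`-path `(L,s̄) → (L,s)` (interlacing,
supplied separately by `stub_strip3_interlaced`).

Proof: reverse the paths and take the first step at the degree-two corner `t` (neighbours `(L,s)`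
and `m = (L+1,1)`; `pathKernel_firstStep_pair`). In `G = S_{L+1} - t` the two remaining new sites
`m`, `n = (L+1,s̄)` form a domino hanging on `(L,1)`, `(L,s̄)`, and `G - m - n = S_L`.
* From `m` (degree two in `G`): first step to `(L,1)` — then `n` is a leaf, never visited
  (`pathKernel_eq_deleteVert_of_leaf`), term `x² Z_{S_L}(a,(L,1))` — or to `n` and on to `(L,s̄)`
  (`pathKernel_firstStep_single`), term `x³ Z_{S_L}(a,(L,s̄))`.
* From `(L,s)`: the paths avoiding `m` are the paths of `G - m`, where `n` is a leaf: term
  `x Z_{S_L}(a,(L,s))` (`stub_pathKernelOn_avoid`); the paths through `m` traverse the domino as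
  the excursion `(L,s̄) n m (L,1)` — the opposite orientation is excluded by the interlacing — and
  are in weight-preserving bijection (`× x³`) with the disjoint pairs `(γ, γ')`: the hanging-domino
  identity `s3dom_pathKernelOn_visit` of the `…Strip3RecCornerAux` module. Term `x⁴ PP`.
-/

noncomputable section

namespace Summit.CriticalPhenomena.SAWScalingLimit.Theorems.BoundaryTP2

open Literature.Probability.LatticeModels Literature.Probability.RandomPlanarGeometry
open Summit.CriticalPhenomena.SAWScalingLimit.Theorems.EdgeOfPositivity.Negative
open scoped ENNReal

/-! ## Coordinates on the 3-row strip -/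

/-- Adjacency in `ℤ²` in coordinates: the sites agree in one coordinate and differ by `1` in the
other (after `…BoundaryTP2LadderKernels`). [folklore] -/
private theorem s3c_zd_adj_iff (u v : Site 2) :
    (zdGraph 2).Adj u v ↔
      ((v 0 = u 0 + 1 ∨ u 0 = v 0 + 1) ∧ v 1 = u 1) ∨
        ((v 1 = u 1 + 1 ∨ u 1 = v 1 + 1) ∧ v 0 = u 0) := by
  rw [zdGraph_adj_iff, Fin.exists_fin_two]
  simp only [funext_iff, Fin.forall_fin_two, Pi.add_apply, Pi.single_eq_same,
    Pi.single_eq_of_ne (one_ne_zero : (1 : Fin 2) ≠ 0),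
    Pi.single_eq_of_ne (zero_ne_one : (0 : Fin 2) ≠ 1), add_zero]
  omega

/-- A site equals `st a b` iff its two coordinates are `a` and `b`. [folklore] -/
private theorem s3c_eq_st_iff (v : Site 2) (a b : ℤ) : v = st a b ↔ v 0 = a ∧ v 1 = b := by
  constructor
  · rintro rfl
    exact ⟨rfl, rfl⟩
  · rintro ⟨h0, h1⟩
    rw [← st_eta v, h0, h1]

/-- Adjacency of the 3-row strip `{0..a} × {0,1,2}` in coordinates. [folklore] -/
private theorem s3c_adj_iff (a : ℕ) (u v : Site 2) :
    (discreteDomainGraph (rectDomain a 2) 1).Adj u v ↔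
      (((v 0 = u 0 + 1 ∨ u 0 = v 0 + 1) ∧ v 1 = u 1) ∨
          ((v 1 = u 1 + 1 ∨ u 1 = v 1 + 1) ∧ v 0 = u 0)) ∧
        ((0 ≤ u 0 ∧ u 0 ≤ a) ∧ (0 ≤ u 1 ∧ u 1 ≤ 2)) ∧
          ((0 ≤ v 0 ∧ v 0 ≤ a) ∧ (0 ≤ v 1 ∧ v 1 ≤ 2)) := by
  rw [adj_rect_iff, s3c_zd_adj_iff, mem_rectSites_iff, mem_rectSites_iff, Nat.cast_ofNat]

/-! ## The last column: corner, domino, deletion -/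

/-- In `S_{L+1}` the corner `t = (L+1,s)` (`s ∈ {0,2}`) has exactly the two neighbours `(L,s)` and
`(L+1,1)`. [folklore] -/
private theorem s3c_corner_neighborSet (L : ℕ) (s : ℤ) (hs : s = 0 ∨ s = 2) :
    (discreteDomainGraph (rectDomain (L + 1) 2) 1).neighborSet (st (L + 1 : ℕ) s) =
      {st L s, st (L + 1 : ℕ) 1} := by
  ext v
  rw [SimpleGraph.mem_neighborSet, s3c_adj_iff, Set.mem_insert_iff, Set.mem_singleton_iff]
  simp only [s3c_eq_st_iff, st_zero, st_one, Nat.cast_succ]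
  omega

/-- In `G = S_{L+1} - t` (`t = (L+1,s)`, `s ∈ {0,2}`) the middle site `m = (L+1,1)` of the last
column has exactly the neighbours `(L,1)` and `n = (L+1,2-s)`. [folklore] -/
private theorem s3c_mid_adj_iff (L : ℕ) (s : ℤ) (hs : s = 0 ∨ s = 2) (z : Site 2) :
    ((discreteDomainGraph (rectDomain (L + 1) 2) 1).deleteEdges
        ((discreteDomainGraph (rectDomain (L + 1) 2) 1).incidenceSet (st (L + 1 : ℕ) s))).Adj
        (st (L + 1 : ℕ) 1) z ↔ z = st L 1 ∨ z = st (L + 1 : ℕ) (2 - s) := by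
  rw [deleteEdges_incidenceSet_adj, s3c_adj_iff]
  simp only [Ne, s3c_eq_st_iff, st_zero, st_one, Nat.cast_succ]
  omega

/-- In `G = S_{L+1} - t` (`t = (L+1,s)`, `s ∈ {0,2}`) the far corner `n = (L+1,2-s)` of the last
column has exactly the neighbours `m = (L+1,1)` and `(L,2-s)`. [folklore] -/
private theorem s3c_far_adj_iff (L : ℕ) (s : ℤ) (hs : s = 0 ∨ s = 2) (z : Site 2) :
    ((discreteDomainGraph (rectDomain (L + 1) 2) 1).deleteEdges
        ((discreteDomainGraph (rectDomain (L + 1) 2) 1).incidenceSet (st (L + 1 : ℕ) s))).Adj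
        (st (L + 1 : ℕ) (2 - s)) z ↔ z = st (L + 1 : ℕ) 1 ∨ z = st L (2 - s) := by
  rw [deleteEdges_incidenceSet_adj, s3c_adj_iff]
  simp only [Ne, s3c_eq_st_iff, st_zero, st_one, Nat.cast_succ]
  omega

/-- Deleting the three sites `(L+1,s)`, `(L+1,1)`, `(L+1,2-s)` of the last column of `S_{L+1}`
(`s ∈ {0,2}`) leaves `S_L`, as an equality of simple graphs on `Site 2`. [folklore] -/
private theorem s3c_delete_lastColumn (L : ℕ) (s : ℤ) (hs : s = 0 ∨ s = 2) :
    (((discreteDomainGraph (rectDomain (L + 1) 2) 1).deleteEdges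
        ((discreteDomainGraph (rectDomain (L + 1) 2) 1).incidenceSet (st (L + 1 : ℕ) s))).deleteEdges
      (((discreteDomainGraph (rectDomain (L + 1) 2) 1).deleteEdges
        ((discreteDomainGraph (rectDomain (L + 1) 2) 1).incidenceSet (st (L + 1 : ℕ) s))).incidenceSet
          (st (L + 1 : ℕ) 1))).deleteEdges
      ((((discreteDomainGraph (rectDomain (L + 1) 2) 1).deleteEdges
        ((discreteDomainGraph (rectDomain (L + 1) 2) 1).incidenceSet (st (L + 1 : ℕ) s))).deleteEdges
      (((discreteDomainGraph (rectDomain (L + 1) 2) 1).deleteEdges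
        ((discreteDomainGraph (rectDomain (L + 1) 2) 1).incidenceSet (st (L + 1 : ℕ) s))).incidenceSet
          (st (L + 1 : ℕ) 1))).incidenceSet (st (L + 1 : ℕ) (2 - s))) =
      discreteDomainGraph (rectDomain L 2) 1 := by
  ext u v
  rw [deleteEdges_incidenceSet_adj, deleteEdges_incidenceSet_adj, deleteEdges_incidenceSet_adj,
    adj_rect_iff, adj_rect_iff, mem_rectSites_iff, mem_rectSites_iff, mem_rectSites_iff,
    mem_rectSites_iff]
  simp only [Ne, s3c_eq_st_iff, Nat.cast_succ]
  constructor
  · rintro ⟨⟨⟨⟨hzd, hu, hv⟩, hut, hvt⟩, hum, hvm⟩, hun, hvn⟩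
    exact ⟨hzd, by omega, by omega⟩
  · rintro ⟨hzd, hu, hv⟩
    exact ⟨⟨⟨⟨hzd, by omega, by omega⟩, by omega, by omega⟩, by omega, by omega⟩, by omega,
      by omega⟩

/-! ## The recursion -/

open Classical in
/-- **Tool stub `stub_strip3_recCorner`.** Last-column recursion for the kernel of the 3-row strip
from `(0,r)` into a CORNER `(L+1,s)`, `s ∈ {0,2}`: last step from `(L,s)` — then the other two new
sites form a hanging domino on `(L,1)`, `(L,2-s)`, used either not at all (kernel of `S_L`) or as the
excursion `(L,2-s) → (L+1,2-s) → (L+1,1) → (L,1)` (disjoint pairs `γ : (0,r) → (L,2-s)`,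
`γ' : (L,1) → (L,s)`; the opposite orientation of the excursion is excluded by the interlacing
hypothesis) — or from `(L+1,1)`, entered from `(L,1)` (leaf `(L+1,2-s)`) or from `(L+1,2-s)` after
`(L,2-s)`. See the module docstring. [folklore] -/
theorem stub_strip3_recCorner (L : ℕ) {x : ℝ} (hx : 0 ≤ x) (r : ℤ) (hr : 0 ≤ r ∧ r ≤ 2) (s : ℤ)
    (hs : s = 0 ∨ s = 2)
    (hI : Interlaced (discreteDomainGraph (rectDomain L 2) 1) (st 0 r) (st L (2 - s)) (st L 1) (st L s)) :
    pathKernel (discreteDomainGraph (rectDomain (L + 1) 2) 1) x (st 0 r) (st (L + 1 : ℕ) s) =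
      ENNReal.ofReal x * pathKernel (discreteDomainGraph (rectDomain L 2) 1) x (st 0 r) (st L s) +
        ENNReal.ofReal (x ^ 2) * pathKernel (discreteDomainGraph (rectDomain L 2) 1) x (st 0 r) (st L 1) +
        ENNReal.ofReal (x ^ 3) * pathKernel (discreteDomainGraph (rectDomain L 2) 1) x (st 0 r) (st L (2 - s)) +
        ENNReal.ofReal (x ^ 4) *
          (∑' (γ : (discreteDomainGraph (rectDomain L 2) 1).Path (st 0 r) (st L (2 - s)))
              (γ' : (discreteDomainGraph (rectDomain L 2) 1).Path (st L 1) (st L s)),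
            (if List.Disjoint γ.1.support γ'.1.support then
              ENNReal.ofReal (x ^ γ.1.length) * ENNReal.ofReal (x ^ γ'.1.length) else 0)) := by
  -- distinctness of the sites involved (columns `0`, `L` versus `L + 1`; rows `s ≠ 1 ≠ 2 - s`)
  have hta : st (L + 1 : ℕ) s ≠ st 0 r := by
    rw [Ne, s3c_eq_st_iff, st_zero, st_one, Nat.cast_succ]; omega
  have hpsm : st (L : ℤ) s ≠ st (L + 1 : ℕ) 1 := by
    rw [Ne, s3c_eq_st_iff, st_zero, st_one, Nat.cast_succ]; omega
  have hma : st (L + 1 : ℕ) 1 ≠ st 0 r := by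
    rw [Ne, s3c_eq_st_iff, st_zero, st_one, Nat.cast_succ]; omega
  have hp1n : st (L : ℤ) 1 ≠ st (L + 1 : ℕ) (2 - s) := by
    rw [Ne, s3c_eq_st_iff, st_zero, st_one, Nat.cast_succ]; omega
  have harn : st 0 r ≠ st (L + 1 : ℕ) (2 - s) := by
    rw [Ne, s3c_eq_st_iff, st_zero, st_one, Nat.cast_succ]; omega
  have hpsn : st (L : ℤ) s ≠ st (L + 1 : ℕ) (2 - s) := by
    rw [Ne, s3c_eq_st_iff, st_zero, st_one, Nat.cast_succ]; omega
  -- first step at the corner `t = (L+1, s)` of the reversed paths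
  rw [pathKernel_comm _ x (st 0 r),
    pathKernel_firstStep_pair _ x hx hta hpsm (s3c_corner_neighborSet L s hs)]
  set G := (discreteDomainGraph (rectDomain (L + 1) 2) 1).deleteEdges
    ((discreteDomainGraph (rectDomain (L + 1) 2) 1).incidenceSet (st (L + 1 : ℕ) s)) with hG
  -- the domino `m = (L+1, 1)`, `n = (L+1, 2-s)` of `G = S_{L+1} - t`
  have hNm : ∀ z, G.Adj (st (L + 1 : ℕ) 1) z ↔ z = st L 1 ∨ z = st (L + 1 : ℕ) (2 - s) :=
    s3c_mid_adj_iff L s hs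
  have hNn : ∀ z, G.Adj (st (L + 1 : ℕ) (2 - s)) z ↔ z = st (L + 1 : ℕ) 1 ∨ z = st L (2 - s) :=
    s3c_far_adj_iff L s hs
  have hNm' : G.neighborSet (st (L + 1 : ℕ) 1) = {st L 1, st (L + 1 : ℕ) (2 - s)} := by
    ext z
    rw [SimpleGraph.mem_neighborSet, hNm z, Set.mem_insert_iff, Set.mem_singleton_iff]
  -- the `m`-branch: first step at `m`; then `n` is a leaf hanging on `(L, 2-s)`
  rw [pathKernel_firstStep_pair G x hx hma hp1n hNm']
  set Gm := G.deleteEdges (G.incidenceSet (st (L + 1 : ℕ) 1)) with hGm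
  have hNn' : Gm.neighborSet (st (L + 1 : ℕ) (2 - s)) = {st L (2 - s)} := by
    ext z
    rw [SimpleGraph.mem_neighborSet, hGm, deleteEdges_incidenceSet_adj, hNn z, Set.mem_singleton_iff]
    simp only [Ne, s3c_eq_st_iff, st_zero, st_one, Nat.cast_succ]
    omega
  have hleaf : ∀ z, Gm.Adj (st (L + 1 : ℕ) (2 - s)) z → z = st L (2 - s) := fun z hz => by
    have hz' : z ∈ Gm.neighborSet (st (L + 1 : ℕ) (2 - s)) := hz
    rwa [hNn', Set.mem_singleton_iff] at hz'
  -- `G - m - n = S_L`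
  have hGR : Gm.deleteEdges (Gm.incidenceSet (st (L + 1 : ℕ) (2 - s))) =
      discreteDomainGraph (rectDomain L 2) 1 :=
    s3c_delete_lastColumn L s hs
  have hRG : ∀ u v, (discreteDomainGraph (rectDomain L 2) 1).Adj u v ↔
      G.Adj u v ∧ (u ≠ st (L + 1 : ℕ) 1 ∧ u ≠ st (L + 1 : ℕ) (2 - s)) ∧
        (v ≠ st (L + 1 : ℕ) 1 ∧ v ≠ st (L + 1 : ℕ) (2 - s)) := by
    intro u v
    rw [← hGR, deleteEdges_incidenceSet_adj, hGm, deleteEdges_incidenceSet_adj]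
    tauto
  rw [pathKernel_eq_deleteVert_of_leaf Gm x hleaf hp1n harn, hGR,
    pathKernel_firstStep_single Gm x hx harn.symm hNn', hGR]
  -- the `(L, s)`-branch: paths avoiding `m` (then `n` is a leaf) and paths through the domino
  have hc : {γ : G.Path (st 0 r) (st L s) | st (L + 1 : ℕ) 1 ∉ γ.1.support}ᶜ =
      {γ | st (L + 1 : ℕ) 1 ∈ γ.1.support} := by
    rw [Set.compl_setOf]
    simp only [not_not]
  rw [pathKernel_comm G x (st (L : ℤ) s) (st 0 r),
    ← pathKernelOn_add_compl x (st 0 r) (st L s)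
      {γ : G.Path (st 0 r) (st L s) | st (L + 1 : ℕ) 1 ∉ γ.1.support},
    stub_pathKernelOn_avoid G x _ _ _ hma.symm hpsm, ← hGm,
    pathKernel_eq_deleteVert_of_leaf Gm x hleaf harn hpsn, hGR, hc,
    s3dom_pathKernelOn_visit G _ x hx hRG hNm hNn hma.symm harn hpsm hpsn hp1n hI]
  -- bookkeeping
  rw [pathKernel_comm (discreteDomainGraph (rectDomain L 2) 1) x (st (L : ℤ) 1) (st 0 r),
    pathKernel_comm (discreteDomainGraph (rectDomain L 2) 1) x (st (L : ℤ) (2 - s)) (st 0 r),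
    ENNReal.ofReal_pow hx, ENNReal.ofReal_pow hx, ENNReal.ofReal_pow hx]
  ring

end Summit.CriticalPhenomena.SAWScalingLimit.Theorems.BoundaryTP2
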